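import Mathlib.LinearAlgebra.Determinant
import Mathlib.Geometry.Manifold.Complex
import Mathlib.Analysis.SpecialFunctions.Trigonometric.Basic
import Literature.Geometry.Kaehler.HolomorphicChartForms
import Literature.AlgebraicGeometry.Surfaces.K3HodgeTypesProofs
import Literature.AlgebraicGeometry.HodgeTheory.HodgeModelConnected
import HarnessLib

/-!
# `h^{2,0} ≤ 1` for K3 surfaces: closed `(2,0)`-forms against a nowhere-vanishing holomorphic `2`-form

On a compact connected complex surface `M` carrying a nowhere-vanishing `2`-form `η` holomorphic
in charts (a trivialisation of the canonical bundle, as in the tree's `IsK3Surface`), every closed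
smooth form of type `(2,0)` is a CONSTANT multiple of `η` (`TwoForms.exists_eq_const_smul`).
Hence for a K3 surface `S` the `(2,0)`-classes form the line spanned by any non-zero one
(`IsK3Surface.twoZero_line`, Huybrechts, *Lectures on K3 Surfaces*, Ch. 1 §2.4 (2.7):
`h^{2,0}(X) = h^0(X, 𝒪_X) = 1` "by definition", i.e. because `Ω²_X ≅ 𝒪_X` and `X` is compact
connected), and by Hodge symmetry the `(0,2)`-classes form the conjugate line
(`IsK3Surface.hodgeTypes_twoZero_zeroTwo`): the first two clauses of the named fact
`Huybrechts_K3_hodgeTypes_H2` (`K3HodgeTypes.lean`), unconditionally. The third clause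
(`H^{1,1} = (ℂσ ⊕ ℂσ̄)^⊥`) is reduced in `K3HodgeTypesProofs.lean` to the bigrading of the cup
product and the Hodge–Riemann inequality `σ̄ ∪ σ ≠ 0`; with the present file its remaining inputs
are exactly those two (`Huybrechts_K3_hodgeTypes_H2_of_hodgeRiemann`,
`Huybrechts_K3_hodgeTypes_H2_of_cupPreservesHodgeType_of_hodgeRiemann`). The theorem
`Huybrechts_K3_twoZero_line` is also the hypothesis `hT` of `Huybrechts_K3_marking_exists.of_facts`.

## The argument (Huybrechts Ch. 1 (2.7); Voisin I §2.3.1 and the proof of Cor. 7.6)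

* `TwoForms.map_vec2_complex_smul_left/right`: a real `2`-form of weight `2` under the rotations
  `v ↦ e^{iθ} v` (the tree's `IsOfType 2 0`, pointwise) is `ℂ`-bilinear (`θ = π/2, π/4`).
* `TwoForms.exists_eq_mul_of_complexHomogeneous`: on a complex plane (`finrank ℂ E = 2`) the
  `ℂ`-bilinear alternating `2`-forms form the line spanned by any non-zero one (coordinates in a
  `ℂ`-basis), so pointwise `β = f η` (`TwoForms.exists_apply_eq_smul`).
* `TwoForms.complexLinear_of_alternatizeUncurryFin_eq_zero`: if `L ∧ a = 0` (Mathlib's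
  `alternatizeUncurryFin (L.smulRight a)`, the alternatisation behind `extDeriv`) for a real-linear
  `L : E → ℂ` and a non-zero `ℂ`-bilinear `a`, then `L` is `ℂ`-linear (evaluate on
  `(i e_j, e₀, e₁)`).
* `TwoForms.differentiableAt_coeff`: in the chart at `x`, `β = F · G` near the centre with `G` the
  real form of the analytic germ of `η` (`IsHolomorphicInCharts`), `dG = 0` at the centre for type
  reasons (`IsHolomorphicInCharts.extDeriv_inChart_eq_zero`) and `dβ = 0` (`β` closed), so the
  product rule leaves `dF ∧ G = 0` at the centre: `dF` is `ℂ`-linear there, i.e. `F` is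
  complex-differentiable at the centre of every chart.
* `TwoForms.exists_eq_const_smul`: hence `f` is `MDifferentiable` for the holomorphic structure
  and constant by Mathlib's maximum principle on compact complex manifolds
  (`MDifferentiable.exists_eq_const_of_compactSpace`).
* `IsK3Surface.twoZero_line`: in the Hodge model `A` of `S` carrying `η`, the de Rham piece
  `H^{2,0}` is therefore `ℂ[η]`, and Hodge types may be read in `A`
  (`hodgePQ_independent_of_hodgeModel_holds`).

## References
* [Huybrechts2016K3] D. Huybrechts, *Lectures on K3 Surfaces*, CUP 2016, Ch. 1 §2.4 (2.7),
  Ch. 3 §1.1, Ch. 6 Prop. 1.2.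
* [VoisinHodgeI2002] C. Voisin, *Hodge Theory and Complex Algebraic Geometry I*, CUP 2002,
  §2.3.1, Cor. 7.6.
-/

noncomputable section

open scoped Manifold ContDiff Topology
open Complex

namespace Literature.AlgebraicGeometry.Surfaces

namespace TwoForms

section LinearAlgebra

variable {𝕜 : Type*} [Field 𝕜] {V : Type*} [AddCommGroup V] [Module 𝕜 V] [TopologicalSpace V]
  {W : Type*} [AddCommGroup W] [Module 𝕜 W] [TopologicalSpace W]

/-- `![v, w] ∘ swap 0 1 = ![w, v]`. [folklore] -/
theorem vec2_comp_swap {α : Type*} (v w : α) : (![v, w] : Fin 2 → α) ∘ Equiv.swap 0 1 = ![w, v] := by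
  funext i
  fin_cases i <;> simp [Equiv.swap_apply_left, Equiv.swap_apply_right]

/-- Antisymmetry of an alternating `2`-form on a pair. [folklore] -/
theorem map_vec2_swap (f : V [⋀^Fin 2]→L[𝕜] W) (v w : V) : f ![w, v] = -f ![v, w] := by
  rw [← vec2_comp_swap v w]
  exact f.toAlternatingMap.map_swap ![v, w] (by decide : (0 : Fin 2) ≠ 1)

/-- Additivity of an alternating `2`-form in the first slot. [folklore] -/
theorem map_vec2_add_left (f : V [⋀^Fin 2]→L[𝕜] W) (x y w : V) :
    f ![x + y, w] = f ![x, w] + f ![y, w] :=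
  f.vecCons_add ![w] x y

/-- Homogeneity of an alternating `2`-form in the first slot. [folklore] -/
theorem map_vec2_smul_left (f : V [⋀^Fin 2]→L[𝕜] W) (c : 𝕜) (x w : V) :
    f ![c • x, w] = c • f ![x, w] :=
  f.vecCons_smul ![w] c x

/-- Additivity of an alternating `2`-form in the second slot. [folklore] -/
theorem map_vec2_add_right (f : V [⋀^Fin 2]→L[𝕜] W) (v x y : V) :
    f ![v, x + y] = f ![v, x] + f ![v, y] := by
  rw [map_vec2_swap f (x + y) v, map_vec2_add_left, map_vec2_swap f x v, map_vec2_swap f y v]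
  abel

/-- Homogeneity of an alternating `2`-form in the second slot. [folklore] -/
theorem map_vec2_smul_right (f : V [⋀^Fin 2]→L[𝕜] W) (c : 𝕜) (v x : V) :
    f ![v, c • x] = c • f ![v, x] := by
  rw [map_vec2_swap f (c • x) v, map_vec2_smul_left, map_vec2_swap f x v, smul_neg]

/-- An alternating `2`-form vanishes on a repeated vector. [folklore] -/
theorem map_vec2_self (f : V [⋀^Fin 2]→L[𝕜] W) (v : V) : f ![v, v] = 0 :=
  f.map_eq_zero_of_eq ![v, v] (i := 0) (j := 1) rfl (by decide)

/-- Negation in the first slot. [folklore] -/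
theorem map_vec2_neg_left (f : V [⋀^Fin 2]→L[𝕜] W) (v w : V) : f ![-v, w] = -f ![v, w] := by
  rw [show -v = (-1 : 𝕜) • v by simp, map_vec2_smul_left, neg_one_smul]

end LinearAlgebra

section Complex

variable {E : Type*} [NormedAddCommGroup E] [NormedSpace ℂ E]

/-- Rotating both arguments: `(fun i ↦ c • ![v, w] i) = ![c • v, c • w]`. [folklore] -/
theorem smul_vec2 (c : ℂ) (v w : E) : (fun i ↦ c • (![v, w] : Fin 2 → E) i) = ![c • v, c • w] := by
  funext i
  fin_cases i <;> rfl

/-- A real scalar acts on a complex vector space through `ℝ ⊆ ℂ`. [folklore] -/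
theorem real_smul_eq (r : ℝ) (v : E) : (r : ℂ) • v = r • v := Complex.coe_smul r v

/-- **A real `2`-form of weight `2` under the rotations `e^{iθ}` is `ℂ`-bilinear**, first slot:
if `B(e^{iθ}v, e^{iθ}w) = e^{2iθ} B(v, w)` for all `θ`, then `B(zv, w) = z B(v, w)`. (The weight
spaces of `U(1)` on `Λ²_ℝ E^* ⊗ ℂ` are the types `(2,0)`, `(1,1)`, `(0,2)` with weights
`2, 0, -2`; weight `2` is `Λ^{2,0} = Λ²_ℂ E^*`. Elementary proof: `θ = π/2` gives
`B(iv, iw) = -B(v, w)`, `θ = π/4` gives `B(v, iw) + B(iv, w) = 2i B(v, w)`, whence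
`B(iv, w) = B(v, iw) = i B(v, w)`.) Voisin I, §2.3.1. [cite: VoisinHodgeI2002, §2.3.1] -/
theorem map_vec2_complex_smul_left (B : E [⋀^Fin 2]→L[ℝ] ℂ)
    (hB : ∀ (θ : ℝ) (v : Fin 2 → E),
      B (fun i ↦ Complex.exp (θ * I) • v i) = Complex.exp (2 * θ * I) * B v)
    (z : ℂ) (v w : E) : B ![z • v, w] = z * B ![v, w] := by
  -- `θ = π/2`: `B(iv, iw) = -B(v, w)`
  have hJ : ∀ v w : E, B ![I • v, I • w] = -B ![v, w] := by
    intro v w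
    have h := hB (Real.pi / 2) ![v, w]
    have h1 : Complex.exp ((Real.pi / 2 : ℝ) * I) = I := by
      rw [Complex.exp_mul_I]
      push_cast
      rw [Complex.cos_pi_div_two, Complex.sin_pi_div_two]
      ring
    have h2 : Complex.exp (2 * (Real.pi / 2 : ℝ) * I) = -1 := by
      push_cast
      rw [show (2 : ℂ) * (Real.pi / 2) * I = Real.pi * I by ring, Complex.exp_pi_mul_I]
    rw [h1, h2, smul_vec2] at h
    rw [h]
    ring
  -- `θ = π/4`: `B(v, iw) + B(iv, w) = 2i B(v, w)`
  have hK : ∀ v w : E, B ![v, I • w] + B ![I • v, w] = 2 * I * B ![v, w] := by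
    intro v w
    have h := hB (Real.pi / 4) ![v, w]
    have hc : Complex.cos (Real.pi / 4 : ℝ) = (Real.sqrt 2 / 2 : ℝ) := by
      rw [← Complex.ofReal_cos, Real.cos_pi_div_four]
    have hs : Complex.sin (Real.pi / 4 : ℝ) = (Real.sqrt 2 / 2 : ℝ) := by
      rw [← Complex.ofReal_sin, Real.sin_pi_div_four]
    have h1 : ∀ u : E, Complex.exp ((Real.pi / 4 : ℝ) * I) • u =
        (Real.sqrt 2 / 2 : ℝ) • u + (Real.sqrt 2 / 2 : ℝ) • (I • u) := by
      intro u
      rw [Complex.exp_mul_I, hc, hs, add_smul, mul_smul, real_smul_eq, real_smul_eq]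
    have h2 : Complex.exp (2 * (Real.pi / 4 : ℝ) * I) = I := by
      rw [show (2 : ℂ) * (Real.pi / 4 : ℝ) * I = (Real.pi / 2 : ℝ) * I by push_cast; ring,
        Complex.exp_mul_I]
      push_cast
      rw [Complex.cos_pi_div_two, Complex.sin_pi_div_two]
      ring
    rw [smul_vec2, h1, h1, h2] at h
    rw [map_vec2_add_left, map_vec2_smul_left, map_vec2_smul_left, map_vec2_add_right,
      map_vec2_add_right, map_vec2_smul_right, map_vec2_smul_right, map_vec2_smul_right,
      map_vec2_smul_right, hJ] at h
    have hr : Real.sqrt 2 / 2 * (Real.sqrt 2 / 2) = (1 / 2 : ℝ) := by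
      rw [div_mul_div_comm, Real.mul_self_sqrt (by norm_num : (0 : ℝ) ≤ 2)]
      norm_num
    have hsq : ((Real.sqrt 2 / 2 : ℝ) : ℂ) * ((Real.sqrt 2 / 2 : ℝ) : ℂ) = 1 / 2 := by
      rw [← Complex.ofReal_mul, hr]
      norm_num
    simp only [Complex.real_smul] at h
    linear_combination (2 : ℂ) * h - (2 : ℂ) * (B ![v, I • w] + B ![I • v, w]) * hsq
  -- `B(iv, w) = i B(v, w)`
  have hI : ∀ v w : E, B ![I • v, w] = I * B ![v, w] := by
    intro v w
    have h := hK (I • v) w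
    rw [hJ, smul_smul, Complex.I_mul_I, neg_one_smul, map_vec2_neg_left] at h
    linear_combination (I / 2) * h + B ![I • v, w] * Complex.I_sq
  -- general `z = re z + i im z`
  have hz : z • v = (z.re : ℝ) • v + (z.im : ℝ) • (I • v) := by
    conv_lhs => rw [← Complex.re_add_im z]
    rw [add_smul, mul_smul, real_smul_eq, real_smul_eq]
  rw [hz, map_vec2_add_left, map_vec2_smul_left, map_vec2_smul_left, Complex.real_smul,
    Complex.real_smul, hI]
  conv_rhs => rw [← Complex.re_add_im z]
  ring

/-- Second slot: `B(v, zw) = z B(v, w)` for a real `2`-form of weight `2` (antisymmetry).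
[cite: VoisinHodgeI2002, §2.3.1] -/
theorem map_vec2_complex_smul_right (B : E [⋀^Fin 2]→L[ℝ] ℂ)
    (hB : ∀ (θ : ℝ) (v : Fin 2 → E),
      B (fun i ↦ Complex.exp (θ * I) • v i) = Complex.exp (2 * θ * I) * B v)
    (z : ℂ) (v w : E) : B ![v, z • w] = z * B ![v, w] := by
  rw [map_vec2_swap B (z • w) v, map_vec2_complex_smul_left B hB, map_vec2_swap B w v]
  ring

/-! #### Dimension two: a `ℂ`-bilinear `2`-form is a multiple of any non-zero `ℂ`-alternating one -/

/-- **Coordinate formula**: a real `2`-form `B` which is `ℂ`-homogeneous in each slot is, in a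
`ℂ`-basis `e₀, e₁` of the plane, `B(v, w) = (v₀ w₁ - v₁ w₀) B(e₀, e₁)`. [folklore] -/
theorem map_vec2_eq_coord (B : E [⋀^Fin 2]→L[ℝ] ℂ)
    (hl : ∀ (z : ℂ) (v w : E), B ![z • v, w] = z * B ![v, w])
    (hr : ∀ (z : ℂ) (v w : E), B ![v, z • w] = z * B ![v, w])
    (e : Module.Basis (Fin 2) ℂ E) (v w : E) :
    B ![v, w] = (e.repr v 0 * e.repr w 1 - e.repr v 1 * e.repr w 0) * B ![e 0, e 1] := by
  have hv : v = e.repr v 0 • e 0 + e.repr v 1 • e 1 := by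
    have h := e.sum_repr v
    rw [Fin.sum_univ_two] at h
    exact h.symm
  have hw : w = e.repr w 0 • e 0 + e.repr w 1 • e 1 := by
    have h := e.sum_repr w
    rw [Fin.sum_univ_two] at h
    exact h.symm
  conv_lhs => rw [hv, hw]
  rw [map_vec2_add_left, hl, hl, map_vec2_add_right, map_vec2_add_right, hr, hr, hr, hr,
    map_vec2_self, map_vec2_self, map_vec2_swap B (e 0) (e 1)]
  ring

/-- The same for a `ℂ`-alternating `2`-form. [folklore] -/
theorem map_vec2_eq_coord_complex (a : E [⋀^Fin 2]→L[ℂ] ℂ) (e : Module.Basis (Fin 2) ℂ E)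
    (v w : E) :
    a ![v, w] = (e.repr v 0 * e.repr w 1 - e.repr v 1 * e.repr w 0) * a ![e 0, e 1] := by
  have h := map_vec2_eq_coord (a.restrictScalars ℝ)
    (fun z v w ↦ by
      simp only [ContinuousAlternatingMap.coe_restrictScalars, map_vec2_smul_left, smul_eq_mul])
    (fun z v w ↦ by
      simp only [ContinuousAlternatingMap.coe_restrictScalars, map_vec2_smul_right, smul_eq_mul])
    e v w
  simpa only [ContinuousAlternatingMap.coe_restrictScalars] using h

/-- A non-zero `ℂ`-alternating `2`-form on a complex plane is non-zero on any `ℂ`-basis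
(`Λ²_ℂ E^*` is a line spanned by `e₀^* ∧ e₁^*`). [folklore] -/
theorem apply_basis_ne_zero (a : E [⋀^Fin 2]→L[ℂ] ℂ) (ha : a ≠ 0)
    (e : Module.Basis (Fin 2) ℂ E) : a ![e 0, e 1] ≠ 0 := by
  intro h0
  apply ha
  ext u
  have hu : u = ![u 0, u 1] := by
    funext j
    fin_cases j <;> rfl
  rw [hu, map_vec2_eq_coord_complex a e, h0, mul_zero, ContinuousAlternatingMap.coe_zero,
    Pi.zero_apply]

/-- **On a complex plane, a real `2`-form which is `ℂ`-homogeneous in each slot is a constant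
multiple of any non-zero `ℂ`-alternating `2`-form** (`dim_ℂ Λ²_ℂ E^* = 1` for `dim_ℂ E = 2`).
[folklore] -/
theorem exists_eq_mul_of_complexHomogeneous (h2 : Module.finrank ℂ E = 2)
    (a : E [⋀^Fin 2]→L[ℂ] ℂ) (ha : a ≠ 0) (B : E [⋀^Fin 2]→L[ℝ] ℂ)
    (hl : ∀ (z : ℂ) (v w : E), B ![z • v, w] = z * B ![v, w])
    (hr : ∀ (z : ℂ) (v w : E), B ![v, z • w] = z * B ![v, w]) :
    ∃ t : ℂ, ∀ u : Fin 2 → E, B u = t * a u := by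
  haveI : Module.Finite ℂ E := Module.finite_of_finrank_eq_succ h2
  set e := Module.finBasisOfFinrankEq ℂ E h2
  have ha01 : a ![e 0, e 1] ≠ 0 := apply_basis_ne_zero a ha e
  refine ⟨B ![e 0, e 1] / a ![e 0, e 1], fun u ↦ ?_⟩
  have hu : u = ![u 0, u 1] := by
    funext j
    fin_cases j <;> rfl
  rw [hu, map_vec2_eq_coord B hl hr e (u 0) (u 1), map_vec2_eq_coord_complex a e (u 0) (u 1),
    div_mul_eq_mul_div, eq_div_iff ha01]
  ring

/-! #### The `∂̄`-equation at a point: `dF ∧ a = 0` forces `dF` to be `ℂ`-linear -/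

/-- `removeNth` on vectors of length three. [folklore] -/
theorem removeNth_zero_vec3 {α : Type*} (x y z : α) : Fin.removeNth 0 ![x, y, z] = ![y, z] := by
  funext j
  fin_cases j <;> rfl

/-- `removeNth` on vectors of length three. [folklore] -/
theorem removeNth_one_vec3 {α : Type*} (x y z : α) : Fin.removeNth 1 ![x, y, z] = ![x, z] := by
  funext j
  fin_cases j <;> rfl

/-- `removeNth` on vectors of length three. [folklore] -/
theorem removeNth_two_vec3 {α : Type*} (x y z : α) : Fin.removeNth 2 ![x, y, z] = ![x, y] := by
  funext j
  fin_cases j <;> rfl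

/-- The `3`-form `L ∧ a` evaluated on `(u, x, y)`:
`(L ∧ a)(u, x, y) = L(u) a(x, y) - L(x) a(u, y) + L(y) a(u, x)` (Mathlib's
`alternatizeUncurryFin`, the alternatisation used by `extDeriv`). [folklore] -/
theorem alternatizeUncurryFin_smulRight_apply (L : E →L[ℝ] ℂ) (a : E [⋀^Fin 2]→L[ℂ] ℂ)
    (u x y : E) :
    ContinuousAlternatingMap.alternatizeUncurryFin (L.smulRight (a.restrictScalars ℝ)) ![u, x, y] =
      L u * a ![x, y] - L x * a ![u, y] + L y * a ![u, x] := by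
  rw [ContinuousAlternatingMap.alternatizeUncurryFin_apply, Fin.sum_univ_three]
  simp only [Matrix.cons_val_zero, Matrix.cons_val_one, Matrix.cons_val_two, Matrix.head_cons,
    Matrix.tail_cons, removeNth_zero_vec3, removeNth_one_vec3, removeNth_two_vec3,
    ContinuousLinearMap.smulRight_apply, ContinuousAlternatingMap.smul_apply,
    ContinuousAlternatingMap.coe_restrictScalars, smul_eq_mul, Fin.val_zero, Fin.val_one,
    Fin.val_two, pow_zero, pow_one, one_smul, neg_smul, neg_one_sq]
  ring

/-- **If `L ∧ a = 0` for a real-linear `L : E → ℂ` and a non-zero `ℂ`-alternating `2`-form `a`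
on the complex plane `E`, then `L` is `ℂ`-linear** — the pointwise content of "`dβ = 0` for a
`(2,0)`-form `β = F η` means `∂̄F = 0`": the `ℂ`-linear part of `L` wedges to a `(3,0)`-form,
which vanishes on a plane, and `L'' ∧ a = 0` forces the antilinear part `L'' = 0`; concretely,
evaluating at `(i e_j, e₀, e₁)` gives `L(i e_j) = i L(e_j)`. [cite: VoisinHodgeI2002, §2.3.1] -/
theorem complexLinear_of_alternatizeUncurryFin_eq_zero (h2 : Module.finrank ℂ E = 2)
    (a : E [⋀^Fin 2]→L[ℂ] ℂ) (ha : a ≠ 0) (L : E →L[ℝ] ℂ)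
    (hL : ContinuousAlternatingMap.alternatizeUncurryFin (L.smulRight (a.restrictScalars ℝ)) = 0) :
    ∀ (z : ℂ) (v : E), L (z • v) = z * L v := by
  haveI : Module.Finite ℂ E := Module.finite_of_finrank_eq_succ h2
  set e := Module.finBasisOfFinrankEq ℂ E h2
  have ha01 : a ![e 0, e 1] ≠ 0 := apply_basis_ne_zero a ha e
  have hev : ∀ u : E, L u * a ![e 0, e 1] - L (e 0) * a ![u, e 1] + L (e 1) * a ![u, e 0] = 0 := by
    intro u
    have h := congrArg (fun f : E [⋀^Fin 3]→L[ℝ] ℂ ↦ f ![u, e 0, e 1]) hL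
    simpa only [alternatizeUncurryFin_smulRight_apply, ContinuousAlternatingMap.coe_zero,
      Pi.zero_apply] using h
  -- `L (i e_j) = i L (e_j)`
  have hI0 : L (I • e 0) = I * L (e 0) := by
    have h := hev (I • e 0)
    rw [map_vec2_smul_left, map_vec2_smul_left, map_vec2_self, smul_zero, mul_zero, add_zero,
      smul_eq_mul, sub_eq_zero] at h
    exact mul_right_cancel₀ ha01 (by rw [h]; ring)
  have hI1 : L (I • e 1) = I * L (e 1) := by
    have h := hev (I • e 1)
    rw [map_vec2_smul_left, map_vec2_smul_left, map_vec2_self, smul_zero, mul_zero, sub_zero,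
      map_vec2_swap a (e 0) (e 1), smul_eq_mul] at h
    exact mul_right_cancel₀ ha01 (by linear_combination h)
  have hIj : ∀ j : Fin 2, L (I • e j) = I * L (e j) := fun j ↦ by
    fin_cases j
    · exact hI0
    · exact hI1
  -- `L (z e_j) = z L (e_j)`
  have hzj : ∀ (z : ℂ) (j : Fin 2), L (z • e j) = z * L (e j) := by
    intro z j
    have hz : z • e j = (z.re : ℝ) • e j + (z.im : ℝ) • (I • e j) := by
      conv_lhs => rw [← Complex.re_add_im z]
      rw [add_smul, mul_smul, real_smul_eq, real_smul_eq]
    rw [hz, map_add, L.map_smul, L.map_smul, hIj, Complex.real_smul, Complex.real_smul]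
    conv_rhs => rw [← Complex.re_add_im z]
    ring
  -- general vectors
  intro z v
  have hv : v = e.repr v 0 • e 0 + e.repr v 1 • e 1 := by
    have h := e.sum_repr v
    rw [Fin.sum_univ_two] at h
    exact h.symm
  conv_lhs => rw [hv, smul_add, smul_smul, smul_smul, map_add, hzj, hzj]
  conv_rhs => rw [hv, map_add, hzj, hzj]
  ring

/-- Packaging: a real-linear `L : E → ℂ` with `L(zv) = z L(v)` is the restriction of scalars of
a `ℂ`-linear map. [folklore] -/
theorem exists_restrictScalars_eq (L : E →L[ℝ] ℂ) (hL : ∀ (z : ℂ) (v : E), L (z • v) = z * L v) :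
    ∃ Lc : E →L[ℂ] ℂ, Lc.restrictScalars ℝ = L :=
  ⟨{ toFun := L
     map_add' := fun v w ↦ map_add L v w
     map_smul' := fun z v ↦ by rw [hL, RingHom.id_apply, smul_eq_mul]
     cont := L.cont }, by
    ext v
    rfl⟩

end Complex

end TwoForms

/-! ### On a complex surface: closed `(2,0)`-forms against a nowhere-vanishing holomorphic `2`-form -/

namespace TwoForms

section Manifold

open Literature.Geometry.Kaehler Literature.NumberTheory.Transcendental Filter Set

variable {E : Type*} [NormedAddCommGroup E] [NormedSpace ℂ E] [FiniteDimensional ℂ E]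
  {M : Type*} [TopologicalSpace M] [ChartedSpace E M] [IsManifold 𝓘(ℝ, E) ∞ M]

omit [FiniteDimensional ℂ E] in
/-- **Pointwise, a `(2,0)`-form on a complex surface is a multiple of any non-zero holomorphic
`2`-form**: if `η` is holomorphic in charts and nowhere zero and `β` has type `(2,0)`, then
`β x = f(x) η x` for a (unique) scalar `f(x)` — `β x` has weight `2`, hence is `ℂ`-bilinear
(`map_vec2_complex_smul_left/right`), and `Λ²_ℂ T^*_x = ℂ η_x` (`dim_ℂ E = 2`).
[cite: VoisinHodgeI2002, §2.3.1] -/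
theorem exists_apply_eq_smul (h2 : Module.finrank ℂ E = 2) {η β : MForm 𝓘(ℝ, E) M ℂ 2}
    (hη : IsHolomorphicInCharts η) (hη0 : ∀ x, η x ≠ 0) (hβ : IsOfType 2 0 β) (x : M) :
    ∃ t : ℂ, β x = t • η x := by
  obtain ⟨a, ha⟩ := hη.exists_apply_eq_restrictScalars x
  have ha0 : a ≠ 0 := by
    intro h0
    apply hη0 x
    rw [ha, h0]
    ext v
    rfl
  have hw : ∀ (θ : ℝ) (v : Fin 2 → E),
      β x (fun i ↦ Complex.exp (θ * I) • v i) = Complex.exp (2 * θ * I) * β x v := by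
    intro θ v
    have h := hβ.2 x θ v
    have hrot : (fun i ↦ tangentRotate E x θ (v i)) = fun i ↦ Complex.exp (θ * I) • v i := rfl
    rw [hrot] at h
    norm_num at h
    exact h
  obtain ⟨t, ht⟩ := exists_eq_mul_of_complexHomogeneous h2 a ha0 (β x)
    (map_vec2_complex_smul_left _ hw) (map_vec2_complex_smul_right _ hw)
  refine ⟨t, ContinuousAlternatingMap.ext fun u ↦ ?_⟩
  rw [ContinuousAlternatingMap.smul_apply, smul_eq_mul]
  refine (ht u).trans ?_
  rw [ha]
  rfl

/-- **The coefficient of a closed `(2,0)`-form against a nowhere-vanishing holomorphic `2`-form is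
holomorphic** (chart at the point): if `β = f η` pointwise with `β` smooth and closed, `η`
holomorphic in charts and nowhere zero on the complex surface `M`, then `f ∘ (chart at x)⁻¹` is
complex-differentiable at the centre of the chart at `x`. In the chart, `β = F · G` with `G` the
(real form underlying the) analytic `ℂ`-bilinear germ of `η`, `dG = 0` at the centre for reasons
of type (`IsHolomorphicInCharts.extDeriv_inChart_eq_zero`), so `0 = dβ = dF ∧ G` there, and
`dF ∧ G = 0` forces `dF` to be `ℂ`-linear (`complexLinear_of_alternatizeUncurryFin_eq_zero`) —
"a closed `(2,0)`-form is holomorphic: `dβ = ∂̄β`" (Voisin I, §2.3.1, proof of Cor. 7.6).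
[cite: VoisinHodgeI2002, §2.3.1 and Cor. 7.6 (proof)] -/
theorem differentiableAt_coeff (h2 : Module.finrank ℂ E = 2) {η β : MForm 𝓘(ℝ, E) M ℂ 2}
    (hη : IsHolomorphicInCharts η) (hη0 : ∀ x, η x ≠ 0)
    (hβs : IsSmoothForm β) (hβc : IsClosedForm β)
    {f : M → ℂ} (hf : ∀ x, β x = f x • η x) (x : M) :
    DifferentiableAt ℂ (f ∘ (extChartAt 𝓘(ℝ, E) x).symm) (extChartAt 𝓘(ℝ, E) x x) := by
  set c := extChartAt 𝓘(ℝ, E) x x with hc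
  set F : E → ℂ := f ∘ (extChartAt 𝓘(ℝ, E) x).symm with hF
  obtain ⟨g, hg, hηg⟩ := hη x
  set G : E → E [⋀^Fin 2]→L[ℝ] ℂ := fun y ↦ (g y).restrictScalars ℝ with hG
  -- (1) `β = F • η` in the chart, hence `β = F • G` near the centre
  have hβF : ∀ y, β.inChart x y = F y • η.inChart x y := by
    intro y
    simp only [MForm.inChart, hf, hF, Function.comp_apply]
    ext v
    rfl
  have hβFG : β.inChart x =ᶠ[𝓝 c] fun y ↦ F y • G y := by
    filter_upwards [hηg] with y hy
    rw [hβF, hy]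
  -- (2) the germ `g` does not vanish at the centre
  have hGc : G c = η x := by
    rw [← MForm.inChart_apply_self η x]
    exact (hηg.eq_of_nhds).symm
  have hgc : g c ≠ 0 := by
    intro h0
    apply hη0 x
    rw [← hGc, hG]
    ext v
    simp only [h0]
    rfl
  -- (3) differentiability of `G`, `β.inChart x` and of the coefficient `F` at the centre
  set R : (E [⋀^Fin 2]→L[ℂ] ℂ) →L[ℝ] (E [⋀^Fin 2]→L[ℝ] ℂ) :=
    ContinuousAlternatingMap.restrictScalarsCLM (𝕜 := ℂ) (E := E) (F := ℂ) (ι := Fin 2) ℝ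
    with hRdef
  have hGD : HasFDerivAt G (R.comp ((fderiv ℂ g c).restrictScalars ℝ)) c :=
    R.hasFDerivAt.comp c (hg.differentiableAt.hasFDerivAt.restrictScalars ℝ)
  have hGd : DifferentiableAt ℝ G c := hGD.differentiableAt
  have hβd : DifferentiableAt ℝ (β.inChart x) c := by
    have h := hβs x
    rw [ModelWithCorners.Boundaryless.range_eq_univ, contDiffWithinAt_univ] at h
    exact h.differentiableAt (by simp)
  obtain ⟨w, hw⟩ : ∃ w : Fin 2 → E, g c w ≠ 0 := by
    refine not_forall.1 fun hall ↦ hgc (ContinuousAlternatingMap.ext fun w ↦ ?_)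
    rw [hall w, ContinuousAlternatingMap.coe_zero, Pi.zero_apply]
  have hGw : G c w ≠ 0 := by simpa [hG] using hw
  have hFq : F =ᶠ[𝓝 c] fun y ↦ β.inChart x y w * (G y w)⁻¹ := by
    have hne : ∀ᶠ y in 𝓝 c, G y w ≠ 0 :=
      (hGd.continuousAlternatingMap_apply_const w).continuousAt.eventually_ne hGw
    filter_upwards [hβFG, hne] with y hy hy0
    rw [hy, ContinuousAlternatingMap.smul_apply, smul_eq_mul, mul_inv_cancel_right₀ hy0]
  have hFd : DifferentiableAt ℝ F c := by
    have h1 : DifferentiableAt ℝ (fun y ↦ β.inChart x y w) c :=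
      hβd.continuousAlternatingMap_apply_const w
    have h2' : DifferentiableAt ℝ (fun y ↦ G y w) c := hGd.continuousAlternatingMap_apply_const w
    have h3 : DifferentiableAt ℝ (fun y ↦ β.inChart x y w * (G y w)⁻¹) c :=
      h1.fun_mul (h2'.fun_inv hGw)
    exact hFq.differentiableAt_iff.2 h3
  -- (4) the exterior derivatives at the centre: `dβ = 0`, `dG = 0`, product rule
  have hd0 : extDeriv (β.inChart x) c = 0 := by
    have h := congrFun hβc x
    rw [mextDeriv_eq_extDerivWithin, ModelWithCorners.Boundaryless.range_eq_univ,
      extDerivWithin_univ] at h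
    exact h
  have hdG : extDeriv G c = 0 := by
    rw [← hηg.extDeriv_eq]
    exact hη.extDeriv_inChart_eq_zero h2 x
  have hD : HasFDerivAt (fun y ↦ F y • G y)
      (F c • fderiv ℝ G c + (fderiv ℝ F c).smulRight (G c)) c :=
    hFd.hasFDerivAt.smul hGd.hasFDerivAt
  have hkey : ContinuousAlternatingMap.alternatizeUncurryFin
      ((fderiv ℝ F c).smulRight ((g c).restrictScalars ℝ)) = 0 := by
    have h := hβFG.extDeriv_eq
    rw [hd0, extDeriv, hD.fderiv, ContinuousAlternatingMap.alternatizeUncurryFin_add,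
      ContinuousAlternatingMap.alternatizeUncurryFin_smul] at h
    have h' : ContinuousAlternatingMap.alternatizeUncurryFin (fderiv ℝ G c) = 0 := hdG
    rw [h', smul_zero, zero_add] at h
    exact h.symm
  -- (5) `dF(c)` is `ℂ`-linear, so `F` is complex-differentiable at `c`
  obtain ⟨Lc, hLc⟩ := exists_restrictScalars_eq _
    (complexLinear_of_alternatizeUncurryFin_eq_zero h2 (g c) hgc _ hkey)
  exact (differentiableAt_iff_restrictScalars ℝ hFd).2 ⟨Lc, hLc⟩

variable [IsManifold 𝓘(ℂ, E) ω M]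

/-- **On a compact connected complex surface with a nowhere-vanishing holomorphic `2`-form `η`,
every closed smooth `(2,0)`-form is a CONSTANT multiple of `η`** (`h^{2,0} ≤ 1` when the
canonical bundle is trivial; Huybrechts, *Lectures on K3 Surfaces*, Ch. 1 §2.4 (2.7): for a K3
surface "`h^{2,0} = 1` … by definition", i.e. `H⁰(X, Ω²_X) = H⁰(X, 𝒪_X) = ℂ`): the coefficient
`f = β/η` is holomorphic on `M` (`differentiableAt_coeff`, in every chart centre, which is
`MDifferentiable` for the holomorphic atlas), hence constant by the maximum principle on the
compact connected `M` (Mathlib's `MDifferentiable.exists_eq_const_of_compactSpace`).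
[cite: Huybrechts2016K3, Ch. 1 §2.4 (2.7)] [cite: VoisinHodgeI2002, Cor. 7.6 (proof)] -/
theorem exists_eq_const_smul [CompactSpace M] [ConnectedSpace M] (h2 : Module.finrank ℂ E = 2)
    {η β : MForm 𝓘(ℝ, E) M ℂ 2} (hη : IsHolomorphicInCharts η) (hη0 : ∀ x, η x ≠ 0)
    (hβs : IsSmoothForm β) (hβc : IsClosedForm β) (hβt : IsOfType 2 0 β) :
    ∃ t : ℂ, β = t • η := by
  choose f hf using fun x ↦ exists_apply_eq_smul h2 hη hη0 hβt x
  have hmd : MDifferentiable 𝓘(ℂ, E) 𝓘(ℂ, ℂ) f := by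
    intro x
    have hd := differentiableAt_coeff h2 hη hη0 hβs hβc hf x
    rw [mdifferentiableAt_iff]
    refine ⟨?_, ?_⟩
    · have hcomp : ContinuousAt ((f ∘ (extChartAt 𝓘(ℝ, E) x).symm) ∘ extChartAt 𝓘(ℝ, E) x) x :=
        hd.continuousAt.comp (continuousAt_extChartAt (I := 𝓘(ℝ, E)) x)
      refine hcomp.congr ?_
      filter_upwards [extChartAt_source_mem_nhds (I := 𝓘(ℝ, E)) x] with z hz
      simp only [Function.comp_apply, (extChartAt 𝓘(ℝ, E) x).left_inv hz]
    · -- the real and complex extended charts of `M` coincide (both corners maps are `id_E`)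
      have hch : extChartAt 𝓘(ℂ, E) x = extChartAt 𝓘(ℝ, E) x := rfl
      rw [ModelWithCorners.Boundaryless.range_eq_univ, differentiableWithinAt_univ,
        writtenInExtChartAt, extChartAt_model_space_eq_id, PartialEquiv.refl_coe,
        Function.id_comp, hch]
      exact hd
  obtain ⟨t, ht⟩ := hmd.exists_eq_const_of_compactSpace (I := 𝓘(ℂ, E))
  refine ⟨t, funext fun x ↦ ?_⟩
  rw [hf x, ht]
  rfl

end Manifold

end TwoForms

/-! ### `h^{2,0} ≤ 1` for K3 surfaces and the first two clauses of `Huybrechts_K3_hodgeTypes_H2` -/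

section K3

open Literature.AlgebraicTopology.SingularHomology Literature.AlgebraicGeometry.HodgeTheory
  Literature.Geometry.Kaehler Literature.NumberTheory.Transcendental

variable {S : Motives.SchemeOver ℂ}

/-- **`h^{2,0}(S) ≤ 1` for a K3 surface** (Huybrechts, *Lectures on K3 Surfaces*, Ch. 1 §2.4
(2.7): `h^{2,0} = h^0(X, Ω²_X) = h^0(X, 𝒪_X) = 1` since `ω_X ≅ 𝒪_X` and `X` is compact
connected): if `σ ≠ 0` is a class of Hodge type `(2,0)` on a K3 surface `S`, every class of type
`(2,0)` is a multiple of `σ`. Proof: in the Hodge model `A` of `S` carrying the nowhere-vanishing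
holomorphic `2`-form `η` (`IsK3Surface`), every closed `(2,0)`-form is a constant multiple of `η`
(`TwoForms.exists_eq_const_smul`: the coefficient is holomorphic, and constant on the compact
connected `A.carrier`), so the de Rham piece `H^{2,0}` is the line `ℂ[η]`; the types of `σ` and
`c` may be read in `A` (`hodgePQ_independent_of_hodgeModel_holds`). This is the hypothesis `hT`
of `Huybrechts_K3_hodgeTypes_H2_of_exists_deRhamIsoFamily` and of
`Huybrechts_K3_marking_exists.of_facts`. [cite: Huybrechts2016K3, Ch. 1 §2.4 (2.7)] -/
theorem IsK3Surface.twoZero_line (hS : IsK3Surface S) {σ : complexBetti S (2 * 1)}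
    (hσ : IsOfHodgeType 2 S (2 * 1) 2 0 σ) (hσ0 : σ ≠ 0)
    (c : complexBetti S (2 * 1)) (hc : IsOfHodgeType 2 S (2 * 1) 2 0 c) : ∃ t : ℂ, c = t • σ := by
  have hX := hS.isSmoothProjective
  obtain ⟨A, η, hη, hη0⟩ := hS.exists_holomorphicTwoForm_ne_zero
  -- topology and dimension of the model
  haveI : CompactSpace A.carrier := by
    haveI : AlgebraicGeometry.IsProper S.hom := Motives.IsSmoothProjective.isProper_holds hX
    haveI : CompactSpace (Motives.ComplexPoints S) :=
      Motives.compactSpace_algPoints_of_isProper_holds S ℂ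
    exact A.isAnalytification.homeomorph.symm.compactSpace
  haveI : ConnectedSpace A.carrier := A.connectedSpace_carrier hX
  have h2 : Module.finrank ℂ A.model = 2 := A.isAnalytification.finrank_eq
  -- the class `[η]` spans the de Rham piece `H^{2,0}` of the model
  have hηZ : η ∈ cclosedSmoothForms A.model A.carrier (2 * 1) := hη.mem_cclosedSmoothForms h2
  have hK : ∀ y ∈ hodgePQ A.model A.carrier (2 * 1) 2 0,
      ∃ t : ℂ, y = t • complexDeRhamCohomology.mk A.model A.carrier (2 * 1) ⟨η, hηZ⟩ := by
    intro y hy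
    induction hy using Submodule.span_induction with
    | mem y hy =>
      obtain ⟨β, hβt, rfl⟩ := hy
      obtain ⟨hβs, hβc⟩ :=
        (mem_cclosedSmoothForms_iff (β : MForm 𝓘(ℝ, A.model) A.carrier ℂ (2 * 1))).1 β.2
      obtain ⟨t, ht⟩ := TwoForms.exists_eq_const_smul h2 hη hη0 hβs hβc hβt
      refine ⟨t, ?_⟩
      rw [← map_smul]
      congr 1
      exact Subtype.ext ht
    | zero => exact ⟨0, by rw [zero_smul]⟩
    | add y z _ _ hy hz =>
      obtain ⟨s, rfl⟩ := hy
      obtain ⟨t, rfl⟩ := hz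
      exact ⟨s + t, by rw [add_smul]⟩
    | smul a y _ hy =>
      obtain ⟨t, rfl⟩ := hy
      exact ⟨a * t, by rw [mul_smul]⟩
  -- read the types of `σ` and `c` in the model `A`
  have hI := hodgePQ_independent_of_hodgeModel_holds
  obtain ⟨yσ, hyσ, hyσe⟩ := (hI.isOfHodgeType_iff hX A).1 hσ
  obtain ⟨yc, hyc, hyce⟩ := (hI.isOfHodgeType_iff hX A).1 hc
  obtain ⟨s, rfl⟩ := hK yσ hyσ
  obtain ⟨t, rfl⟩ := hK yc hyc
  have hs0 : s ≠ 0 := by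
    rintro rfl
    apply hσ0
    apply A.pullback_injective (2 * 1)
    rw [← hyσe, zero_smul, map_zero, map_zero]
  refine ⟨t * s⁻¹, A.pullback_injective (2 * 1) ?_⟩
  rw [map_smul, ← hyσe, ← hyce, map_smul, map_smul, smul_smul, inv_mul_cancel_right₀ hs0]

/-- `h^{2,0} ≤ 1` for K3 surfaces, closed form: the hypothesis `hT` of
`Huybrechts_K3_hodgeTypes_H2_of_exists_deRhamIsoFamily` /
`Huybrechts_K3_marking_exists.of_facts`, now a theorem. [cite: Huybrechts2016K3, Ch. 1 §2.4 (2.7)] -/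
theorem Huybrechts_K3_twoZero_line :
    ∀ (S : Motives.SchemeOver ℂ), IsK3Surface S →
      ∀ σ : complexBetti S (2 * 1), IsOfHodgeType 2 S (2 * 1) 2 0 σ → σ ≠ 0 →
        ∀ c : complexBetti S (2 * 1), IsOfHodgeType 2 S (2 * 1) 2 0 c → ∃ t : ℂ, c = t • σ :=
  fun _ hS _ hσ hσ0 c hc ↦ hS.twoZero_line hσ hσ0 c hc

/-- **Clauses (2,0) and (0,2) of `Huybrechts_K3_hodgeTypes_H2`, unconditionally**: on a K3
surface, for a non-zero `(2,0)`-class `σ`, the `(2,0)`-classes are exactly `ℂσ` and the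
`(0,2)`-classes exactly `ℂσ̄` (Huybrechts Ch. 3 §1.1 / Ch. 6 Prop. 1.2: `H^{2,0} = ℂσ`,
`H^{0,2} = ℂσ̄`), from `IsK3Surface.twoZero_line` and Hodge symmetry
(`isOfHodgeType_swap_iff_of_line`). [cite: Huybrechts2016K3, Ch. 3 §1.1 and Ch. 6 Prop. 1.2] -/
theorem IsK3Surface.hodgeTypes_twoZero_zeroTwo (hS : IsK3Surface S) {σ : complexBetti S (2 * 1)}
    (hσ : IsOfHodgeType 2 S (2 * 1) 2 0 σ) (hσ0 : σ ≠ 0) :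
    (∀ c : complexBetti S (2 * 1), IsOfHodgeType 2 S (2 * 1) 2 0 c ↔ ∃ t : ℂ, c = t • σ) ∧
      (∀ c : complexBetti S (2 * 1),
        IsOfHodgeType 2 S (2 * 1) 0 2 c ↔
          ∃ t : ℂ, c = t • conjClass (Motives.ComplexPoints S) (2 * 1) σ) := by
  have h20 : ∀ c : complexBetti S (2 * 1), IsOfHodgeType 2 S (2 * 1) 2 0 c ↔ ∃ t : ℂ, c = t • σ :=
    fun c ↦ ⟨hS.twoZero_line hσ hσ0 c, fun ⟨t, ht⟩ ↦ ht ▸ hσ.smul t⟩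
  exact ⟨h20, isOfHodgeType_swap_iff_of_line hS.isSmoothProjective h20⟩

/-- **`Huybrechts_K3_hodgeTypes_H2` from de Rham's theorem (multiplicative form) and the
Hodge–Riemann inequality `σ̄ ∪ σ ≠ 0` alone**: the tree's
`Huybrechts_K3_hodgeTypes_H2_of_exists_deRhamIsoFamily` with its first hypothesis
(`h^{2,0} ≤ 1`) discharged by `Huybrechts_K3_twoZero_line`.
[cite: Huybrechts2016K3, Ch. 1 (2.7); Ch. 6 Prop. 1.2 (ii), (iii)] [cite: WarnerGTM94, Thm. 5.36 / Thm. 5.45] -/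
theorem Huybrechts_K3_hodgeTypes_H2_of_hodgeRiemann
    (hdR : ∀ (E : Type) [NormedAddCommGroup E] [NormedSpace ℂ E] [FiniteDimensional ℂ E],
      exists_deRhamIsoFamily 𝓘(ℝ, E))
    (hHR : ∀ (S : Motives.SchemeOver ℂ), IsK3Surface S →
      ∀ σ : complexBetti S (2 * 1), IsOfHodgeType 2 S (2 * 1) 2 0 σ → σ ≠ 0 →
        cupProduct (rfl : 2 * 1 + 2 * 1 = 2 * 2) (conjClass (Motives.ComplexPoints S) (2 * 1) σ) σ ≠ 0) :
    Huybrechts_K3_hodgeTypes_H2 :=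
  Huybrechts_K3_hodgeTypes_H2_of_exists_deRhamIsoFamily Huybrechts_K3_twoZero_line hdR hHR

/-- The same with the bigrading of the cup product (`CupPreservesHodgeType 2 S` for K3 surfaces)
in place of de Rham's theorem. [cite: Huybrechts2016K3, Ch. 6 Prop. 1.2 (ii), (iii)]
[cite: VoisinHodgeI2002, Cor. 6.12 and Lemma 7.30] -/
theorem Huybrechts_K3_hodgeTypes_H2_of_cupPreservesHodgeType_of_hodgeRiemann
    (hcup : ∀ (S : Motives.SchemeOver ℂ), IsK3Surface S → CupPreservesHodgeType 2 S)
    (hHR : ∀ (S : Motives.SchemeOver ℂ), IsK3Surface S →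
      ∀ σ : complexBetti S (2 * 1), IsOfHodgeType 2 S (2 * 1) 2 0 σ → σ ≠ 0 →
        cupProduct (rfl : 2 * 1 + 2 * 1 = 2 * 2) (conjClass (Motives.ComplexPoints S) (2 * 1) σ) σ ≠ 0) :
    Huybrechts_K3_hodgeTypes_H2 :=
  Huybrechts_K3_hodgeTypes_H2_of_cupPreservesHodgeType Huybrechts_K3_twoZero_line hcup hHR

end K3

end Literature.AlgebraicGeometry.Surfaces

end
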